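import Literature.Topology.FourManifolds.MMSWPictureGeneralPosition
import Literature.Topology.FourManifolds.DehnSurgeryTubularNbhdProofs
import Literature.Topology.FourManifolds.KirbyMoves
import HarnessLib

/-!
# The outer chart of the standard picture: a Möbius dilation adapted to the outer core

Topic `Literature/Topology/FourManifolds`; part of the proof of the named fact
`Literature.Topology.FourManifolds.pictureSurgeryPresentation` (`MMSWPictureSurgery.lean`; Kirby,
*The Topology of 4-Manifolds*, LNM 1374 (1989), Ch. I §2, Lemma 2.1; Manolescu–Marengon–Sarkar–
Willis, Duke Math. J. 172 (2023), Def. 8.26 / Remark 8.27).  Everything here is proved; no named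
fact is introduced.

The standard picture `MMSW.draw` places the planar domain of the model boundary `M_k` in the
vertical half-plane `{(ρ, h)}`, `ρ = Re z + C_k`, `h = Im z`, `C_k = drawRadius k = 100(k+1)`, and
revolves it about the vertical axis.  Near the OUTER core circle of `M_k` (`w = 0`,
`|z| ≈ R'_k = 40(k+1)`) the picture accumulates on the torus obtained by revolving the circle
`|z| = R'_k`, whose complementary solid torus in `𝕊³` is a neighbourhood of the axis
`A = {x₀ = x₁ = 0} ∪ {∞}`.  To extend a compressed picture smoothly over that core one needs
coordinates on `𝕊³` adapted to `A` in which the circle `|z| = R'_k` of the half-plane is a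
coordinate circle.  They are provided by the Möbius transformation `𝔇_a` of `𝕊³` that is the
dilation by `a` in the stereographic chart (`dilCoe`, `dilCoe_stereoNorthInvCoe`), with
`a = focal k = √(C_k² − R'_k²)`: after dilating by `1/a` the revolved circle `|z| = R'_k` becomes
the "latitude torus" `x₀² + x₁² = c²`, `c = a / C_k`, of the axis circle `x₀ = x₁ = 0` of `𝕊³`.
Accordingly we introduce the tube coordinates `axisTubeVec e ζ = (ζ, √(1 − |ζ|²) e)` about that
circle (`e ∈ 𝕊¹` the position along the axis circle, `ζ` in the unit disc the transverse
coordinate), the outer chart `outerPt k e ζ = 𝔇_a (axisTubeVec e ζ)`, and, on the planar side,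
the "latitude" `latS k z = 2aρ/(ρ² + h² + a²)` and "co-latitude vector"
`coLat k z = (2ah, ρ² + h² − a²)/(ρ² + h² + a²)` of a planar point, with the basic identities:
`latS² + |coLat|² = 1`, the picture point of `(z, u)` is `outerPt k (coLat/|coLat|) (latS • u)`
(`outerPt_coLatDir_latS`), the inverse parametrisation `outerZ k e s` of the planar half-plane by
(direction of `coLat`, `latS`) (`latS_outerZ`, `coLat_outerZ`, `outerZ_coLatDir_latS`), and the
exact formula `|outerZ k e s|² = R'_k² + 2a(a − C_k s)/(1 − √(1 − s²) e₁)` (`normSq_outerZ`), from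
which the transversality of the level curves of the planar potential to these coordinates near the
outer core is derived in the sequel.

## References

* R. Kirby, *The Topology of 4-Manifolds*, LNM 1374 (1989), Ch. I §2. [Kirby1989]
* C. Manolescu, M. Marengon, S. Sarkar, M. Willis, Duke Math. J. 172 (2023), Def. 8.26,
  Remark 8.27. [ManolescuMarengonSarkarWillis2023]
* D. Rolfsen, *Knots and Links* (1976), §3.E (stereographic projection). [Rolfsen1976]
-/

open scoped Manifold ContDiff Topology Real
open Function Set

noncomputable section

namespace Literature.Topology.FourManifolds

/-- Local notation: `𝔼 n` is the model Euclidean space `EuclideanSpace ℝ (Fin n)`. -/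
local notation "𝔼 " n:arg => EuclideanSpace ℝ (Fin n)

/-- Local notation: `𝕊 n` is the unit sphere in `EuclideanSpace ℝ (Fin (n + 1))`. -/
local notation "𝕊 " n:arg => (Metric.sphere (0 : EuclideanSpace ℝ (Fin (n + 1))) 1)

namespace MMSW

open Literature.AlgebraicTopology.Homotopy.HopfFibration (zC wC)

variable {k : ℕ}

/-! ## The constants `R'_k`, `a = focal k` -/

/-- The outer radius `R'_k = 40(k+1)` of the planar potential (`planarPot`). [folklore] -/
def bigRadius (k : ℕ) : ℝ := 40 * ((k : ℝ) + 1)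

/-- `R'_k > 0`. [folklore] -/
theorem bigRadius_pos : 0 < bigRadius k := by unfold bigRadius; positivity

/-- The planar potential in terms of `R'_k`. [folklore] -/
theorem planarPot_eq_bigRadius (z : ℂ) : planarPot k z =
    Complex.normSq z / bigRadius k ^ 2 + ∑ j : Fin k, 1 / Complex.normSq (z - holeCentre k j) :=
  rfl

/-- `C_k = (5/2) R'_k`. [folklore] -/
theorem drawRadius_eq_bigRadius : drawRadius k = 5 / 2 * bigRadius k := by
  unfold drawRadius bigRadius; ring

/-- **The focal parameter** `a = √(C_k² − R'_k²) = (k+1)√8400` of the outer chart. [folklore] -/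
def focal (k : ℕ) : ℝ := Real.sqrt 8400 * ((k : ℝ) + 1)

/-- `a > 0`. [folklore] -/
theorem focal_pos : 0 < focal k := by unfold focal; positivity

/-- `a ≠ 0`. [folklore] -/
theorem focal_ne_zero : focal k ≠ 0 := focal_pos.ne'

/-- `a² = C_k² − R'_k²`. [folklore] -/
theorem focal_sq : focal k ^ 2 = drawRadius k ^ 2 - bigRadius k ^ 2 := by
  unfold focal drawRadius bigRadius
  rw [mul_pow, Real.sq_sqrt (by norm_num)]
  ring

/-- `91(k+1) < a`. [folklore] -/
theorem lt_focal : 91 * ((k : ℝ) + 1) < focal k := by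
  unfold focal
  have h : (91 : ℝ) < Real.sqrt 8400 := by
    rw [show (91 : ℝ) = Real.sqrt (91 ^ 2) by rw [Real.sqrt_sq (by norm_num)]]
    exact Real.sqrt_lt_sqrt (by norm_num) (by norm_num)
  have hk : (0 : ℝ) < (k : ℝ) + 1 := by positivity
  nlinarith

/-- `a < 92(k+1)`. [folklore] -/
theorem focal_lt : focal k < 92 * ((k : ℝ) + 1) := by
  unfold focal
  have h : Real.sqrt 8400 < 92 := by
    rw [show (92 : ℝ) = Real.sqrt (92 ^ 2) by rw [Real.sqrt_sq (by norm_num)]]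
    exact Real.sqrt_lt_sqrt (by norm_num) (by norm_num)
  have hk : (0 : ℝ) < (k : ℝ) + 1 := by positivity
  nlinarith

/-- `a < C_k`. [folklore] -/
theorem focal_lt_drawRadius : focal k < drawRadius k := by
  have := focal_lt (k := k)
  unfold drawRadius
  have hk : (0 : ℝ) < (k : ℝ) + 1 := by positivity
  nlinarith

/-! ## The Möbius dilation `𝔇_a` of `𝕊³` -/

/-- The denominator `a²(1 + x₃) + (1 − x₃)` of the Möbius dilation. [folklore] -/
def dilDen (a : ℝ) (x : 𝔼 4) : ℝ := a ^ 2 * (1 + x 3) + (1 - x 3)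

/-- **The Möbius dilation** `𝔇_a : ℝ⁴ → ℝ⁴`,
`x ↦ (2a x₀, 2a x₁, 2a x₂, a²(1 + x₃) − (1 − x₃)) / (a²(1 + x₃) + (1 − x₃))`: the conformal
transformation of `𝕊³` that reads as the dilation `y ↦ a y` in the stereographic chart from the
north pole (`dilCoe_stereoNorthInvCoe`); it fixes both poles. [folklore] -/
def dilCoe (a : ℝ) (x : 𝔼 4) : 𝔼 4 :=
  WithLp.toLp 2 ![2 * a * x 0 / dilDen a x, 2 * a * x 1 / dilDen a x, 2 * a * x 2 / dilDen a x,
    (a ^ 2 * (1 + x 3) - (1 - x 3)) / dilDen a x]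

/-- Coordinate `0` of `𝔇_a x`. [folklore] -/
@[simp] theorem dilCoe_apply_zero (a : ℝ) (x : 𝔼 4) : dilCoe a x 0 = 2 * a * x 0 / dilDen a x := rfl
/-- Coordinate `1` of `𝔇_a x`. [folklore] -/
@[simp] theorem dilCoe_apply_one (a : ℝ) (x : 𝔼 4) : dilCoe a x 1 = 2 * a * x 1 / dilDen a x := rfl
/-- Coordinate `2` of `𝔇_a x`. [folklore] -/
@[simp] theorem dilCoe_apply_two (a : ℝ) (x : 𝔼 4) : dilCoe a x 2 = 2 * a * x 2 / dilDen a x := rfl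
/-- Coordinate `3` of `𝔇_a x`. [folklore] -/
@[simp] theorem dilCoe_apply_three (a : ℝ) (x : 𝔼 4) :
    dilCoe a x 3 = (a ^ 2 * (1 + x 3) - (1 - x 3)) / dilDen a x := rfl

/-- The denominator is positive when `|x₃| ≤ 1` and `a ≠ 0`. [folklore] -/
theorem dilDen_pos {a : ℝ} (ha : a ≠ 0) {x : 𝔼 4} (hx : |x 3| ≤ 1) : 0 < dilDen a x := by
  unfold dilDen
  have h1 : 0 ≤ 1 + x 3 := by linarith [(abs_le.1 hx).1]
  have h2 : 0 ≤ 1 - x 3 := by linarith [(abs_le.1 hx).2]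
  have ha2 : 0 < a ^ 2 := by positivity
  rcases h2.eq_or_lt with h | h
  · have : x 3 = 1 := by linarith
    rw [this]; nlinarith
  · nlinarith

/-- A coordinate is bounded by the norm. [folklore] -/
theorem abs_apply_le_norm_four (x : 𝔼 4) (i : Fin 4) : |x i| ≤ ‖x‖ := by
  rw [EuclideanSpace.norm_eq]
  refine Real.abs_le_sqrt ?_
  have h : x i ^ 2 = ‖x i‖ ^ 2 := by rw [Real.norm_eq_abs, sq_abs]
  rw [h]
  exact Finset.single_le_sum (f := fun j ↦ ‖x j‖ ^ 2) (fun j _ ↦ by positivity) (Finset.mem_univ i)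

/-- The denominator is positive on the unit sphere (`a ≠ 0`). [folklore] -/
theorem dilDen_pos_of_norm_eq_one {a : ℝ} (ha : a ≠ 0) {x : 𝔼 4} (hx : ‖x‖ = 1) :
    0 < dilDen a x :=
  dilDen_pos ha ((abs_apply_le_norm_four x 3).trans hx.le)

/-- **`𝔇_a` preserves the unit sphere.** [folklore] -/
theorem norm_dilCoe {a : ℝ} {x : 𝔼 4} (hD : dilDen a x ≠ 0) (hx : ‖x‖ = 1) : ‖dilCoe a x‖ = 1 := by
  have hsq : x 0 ^ 2 + x 1 ^ 2 + x 2 ^ 2 + x 3 ^ 2 = 1 := by rw [← norm_sq_fin_four, hx, one_pow]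
  have h : ‖dilCoe a x‖ ^ 2 = 1 := by
    rw [norm_sq_fin_four]
    simp only [dilCoe_apply_zero, dilCoe_apply_one, dilCoe_apply_two, dilCoe_apply_three]
    rw [div_pow, div_pow, div_pow, div_pow, ← add_div, ← add_div, ← add_div,
      div_eq_one_iff_eq (pow_ne_zero 2 hD)]
    unfold dilDen
    nlinarith [hsq]
  have h0 : 0 ≤ ‖dilCoe a x‖ := norm_nonneg _
  nlinarith [h, h0]

/-- **`𝔇_a` is the dilation by `a` in the stereographic chart**:
`𝔇_a (σ⁻¹ y) = σ⁻¹ (a • y)`. [folklore] -/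
theorem dilCoe_stereoNorthInvCoe (a : ℝ) (y : (ℝ × ℝ) × ℝ) :
    dilCoe a (stereoNorthInvCoe y) = stereoNorthInvCoe (a • y) := by
  have h := stereoNorthRadSq_add_one_pos y
  have h' := stereoNorthRadSq_add_one_pos (a • y)
  have hD : dilDen a (stereoNorthInvCoe y) = 2 * (stereoNorthRadSq (a • y) + 1) /
      (stereoNorthRadSq y + 1) := by
    unfold dilDen
    simp only [stereoNorthInvCoe_apply_three, stereoNorthRadSq, Prod.smul_fst, Prod.smul_snd,
      smul_eq_mul]
    field_simp
    ring
  have hD0 : dilDen a (stereoNorthInvCoe y) ≠ 0 := by rw [hD]; positivity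
  have hD0' := hD0
  rw [hD] at hD0'
  ext i
  fin_cases i
  · show dilCoe a (stereoNorthInvCoe y) 0 = stereoNorthInvCoe (a • y) 0
    rw [dilCoe_apply_zero, hD, stereoNorthInvCoe_apply_zero, stereoNorthInvCoe_apply_zero]
    simp only [stereoNorthRadSq, Prod.smul_fst, Prod.smul_snd, smul_eq_mul] at hD0' ⊢
    field_simp
  · show dilCoe a (stereoNorthInvCoe y) 1 = stereoNorthInvCoe (a • y) 1
    rw [dilCoe_apply_one, hD, stereoNorthInvCoe_apply_one, stereoNorthInvCoe_apply_one]
    simp only [stereoNorthRadSq, Prod.smul_fst, Prod.smul_snd, smul_eq_mul] at hD0' ⊢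
    field_simp
  · show dilCoe a (stereoNorthInvCoe y) 2 = stereoNorthInvCoe (a • y) 2
    rw [dilCoe_apply_two, hD, stereoNorthInvCoe_apply_two, stereoNorthInvCoe_apply_two]
    simp only [stereoNorthRadSq, Prod.smul_fst, Prod.smul_snd, smul_eq_mul] at hD0' ⊢
    field_simp
  · show dilCoe a (stereoNorthInvCoe y) 3 = stereoNorthInvCoe (a • y) 3
    rw [dilCoe_apply_three, hD, stereoNorthInvCoe_apply_three, stereoNorthInvCoe_apply_three]
    simp only [stereoNorthRadSq, Prod.smul_fst, Prod.smul_snd, smul_eq_mul] at hD0' ⊢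
    field_simp
    ring

/-- `1 + (𝔇_a x)₃ = 2a²(1 + x₃)/D`. [folklore] -/
theorem one_add_dilCoe_apply_three {a : ℝ} {x : 𝔼 4} (hD : dilDen a x ≠ 0) :
    1 + dilCoe a x 3 = 2 * a ^ 2 * (1 + x 3) / dilDen a x := by
  rw [dilCoe_apply_three, eq_div_iff hD, add_mul, div_mul_cancel₀ _ hD]
  unfold dilDen
  ring

/-- `1 - (𝔇_a x)₃ = 2(1 - x₃)/D`. [folklore] -/
theorem one_sub_dilCoe_apply_three {a : ℝ} {x : 𝔼 4} (hD : dilDen a x ≠ 0) :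
    1 - dilCoe a x 3 = 2 * (1 - x 3) / dilDen a x := by
  rw [dilCoe_apply_three, eq_div_iff hD, sub_mul, div_mul_cancel₀ _ hD]
  unfold dilDen
  ring

/-- The denominator of a composite dilation. [folklore] -/
theorem dilDen_dilCoe {a : ℝ} (b : ℝ) {x : 𝔼 4} (hD : dilDen a x ≠ 0) :
    dilDen b (dilCoe a x) = 2 * dilDen (a * b) x / dilDen a x := by
  rw [dilDen, one_add_dilCoe_apply_three hD, one_sub_dilCoe_apply_three hD]
  unfold dilDen
  field_simp

/-- **Composition of dilations**: `𝔇_b ∘ 𝔇_a = 𝔇_{ab}` wherever both are defined. [folklore] -/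
theorem dilCoe_dilCoe {a : ℝ} (b : ℝ) {x : 𝔼 4} (hD : dilDen a x ≠ 0) (hab : dilDen (a * b) x ≠ 0) :
    dilCoe b (dilCoe a x) = dilCoe (a * b) x := by
  have hD' := dilDen_dilCoe b hD
  have h3p := one_add_dilCoe_apply_three hD
  have h3m := one_sub_dilCoe_apply_three hD
  ext i
  fin_cases i
  · simp only [Fin.zero_eta, Fin.isValue, dilCoe_apply_zero, hD']
    field_simp
  · simp only [Fin.mk_one, Fin.isValue, dilCoe_apply_one, hD']
    field_simp
  · simp only [Fin.reduceFinMk, Fin.isValue, dilCoe_apply_two, hD']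
    field_simp
  · show dilCoe b (dilCoe a x) 3 = dilCoe (a * b) x 3
    have hnum : b ^ 2 * (1 + dilCoe a x 3) - (1 - dilCoe a x 3) =
        2 * (a ^ 2 * b ^ 2 * (1 + x 3) - (1 - x 3)) / dilDen a x := by
      rw [h3p, h3m]
      field_simp
    rw [dilCoe_apply_three b, hnum, hD', dilCoe_apply_three]
    field_simp

/-- `𝔇_1 = id`. [folklore] -/
theorem dilCoe_one (x : 𝔼 4) : dilCoe 1 x = x := by
  have hD : dilDen 1 x = 2 := by unfold dilDen; ring
  ext i
  fin_cases i <;>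
    simp only [Fin.zero_eta, Fin.isValue, Fin.mk_one, Fin.reduceFinMk, dilCoe_apply_zero,
      dilCoe_apply_one, dilCoe_apply_two, dilCoe_apply_three, hD] <;> ring

/-- **`𝔇_{1/a}` inverts `𝔇_a`.** [folklore] -/
theorem dilCoe_inv_dilCoe {a : ℝ} (ha : a ≠ 0) {x : 𝔼 4} (hD : dilDen a x ≠ 0) :
    dilCoe a⁻¹ (dilCoe a x) = x := by
  have h1 : dilDen (a * a⁻¹) x ≠ 0 := by
    rw [mul_inv_cancel₀ ha]
    unfold dilDen
    norm_num
  rw [dilCoe_dilCoe _ hD h1, mul_inv_cancel₀ ha, dilCoe_one]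

/-- **`𝔇_a` is smooth** wherever its denominator does not vanish. [folklore] -/
theorem contDiffAt_dilCoe {a : ℝ} {x : 𝔼 4} (hD : dilDen a x ≠ 0) {n : WithTop ℕ∞} :
    ContDiffAt ℝ n (dilCoe a) x := by
  have hc : ∀ i : Fin 4, ContDiff ℝ n fun z : 𝔼 4 ↦ z i := fun i ↦
    (EuclideanSpace.proj i : 𝔼 4 →L[ℝ] ℝ).contDiff
  have hden : ContDiff ℝ n (dilDen a) := by
    unfold dilDen
    exact (contDiff_const.mul (contDiff_const.add (hc 3))).add (contDiff_const.sub (hc 3))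
  rw [contDiffAt_euclidean]
  intro i
  fin_cases i
  · exact ((contDiff_const.mul (hc 0)).contDiffAt).div hden.contDiffAt hD
  · exact ((contDiff_const.mul (hc 1)).contDiffAt).div hden.contDiffAt hD
  · exact ((contDiff_const.mul (hc 2)).contDiffAt).div hden.contDiffAt hD
  · exact (((contDiff_const.mul (contDiff_const.add (hc 3))).sub
      (contDiff_const.sub (hc 3))).contDiffAt).div hden.contDiffAt hD

/-- **The stereographic coordinates of `𝔇_a x` are `a` times those of `x`** (off the north
pole). [folklore] -/
theorem stereoNorthCoords_dilCoe {a : ℝ} {x : 𝔼 4} (hD : dilDen a x ≠ 0) (hx : x 3 ≠ 1) :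
    stereoNorthCoords (dilCoe a x) = a • stereoNorthCoords x := by
  have h3 : 1 - x 3 ≠ 0 := sub_ne_zero.2 (Ne.symm hx)
  have h1 : 1 - dilCoe a x 3 = 2 * (1 - x 3) / dilDen a x := one_sub_dilCoe_apply_three hD
  simp only [stereoNorthCoords, h1, dilCoe_apply_zero, dilCoe_apply_one, dilCoe_apply_two,
    Prod.smul_mk, smul_eq_mul, Prod.mk.injEq]
  refine ⟨⟨?_, ?_⟩, ?_⟩ <;> field_simp

/-! ## Tube coordinates about the axis circle `{x₀ = x₁ = 0}` of `𝕊³` -/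

/-- **Tube coordinates about the great circle `{x₀ = x₁ = 0}`** of `𝕊³`:
`(e, ζ) ↦ (ζ₀, ζ₁, √(1 − |ζ|²) e₀, √(1 − |ζ|²) e₁)` — `e ∈ 𝕊¹` the position along the circle,
`ζ` in the open unit disc the transverse coordinate (the meridian discs are `ζ ↦ ·` at fixed
`e`). [folklore] -/
def axisTubeVec (e ζ : 𝔼 2) : 𝔼 4 :=
  WithLp.toLp 2 ![ζ 0, ζ 1, Real.sqrt (1 - ‖ζ‖ ^ 2) * e 0, Real.sqrt (1 - ‖ζ‖ ^ 2) * e 1]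

/-- Coordinate `0` of the tube coordinates. [folklore] -/
@[simp] theorem axisTubeVec_apply_zero (e ζ : 𝔼 2) : axisTubeVec e ζ 0 = ζ 0 := rfl
/-- Coordinate `1` of the tube coordinates. [folklore] -/
@[simp] theorem axisTubeVec_apply_one (e ζ : 𝔼 2) : axisTubeVec e ζ 1 = ζ 1 := rfl
/-- Coordinate `2` of the tube coordinates. [folklore] -/
@[simp] theorem axisTubeVec_apply_two (e ζ : 𝔼 2) :
    axisTubeVec e ζ 2 = Real.sqrt (1 - ‖ζ‖ ^ 2) * e 0 := rfl
/-- Coordinate `3` of the tube coordinates. [folklore] -/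
@[simp] theorem axisTubeVec_apply_three (e ζ : 𝔼 2) :
    axisTubeVec e ζ 3 = Real.sqrt (1 - ‖ζ‖ ^ 2) * e 1 := rfl

/-- The tube coordinates land on the unit sphere. [folklore] -/
theorem norm_axisTubeVec {e ζ : 𝔼 2} (he : ‖e‖ = 1) (hζ : ‖ζ‖ ≤ 1) : ‖axisTubeVec e ζ‖ = 1 := by
  have h1 : 0 ≤ 1 - ‖ζ‖ ^ 2 := by nlinarith [norm_nonneg ζ]
  have he2 : e 0 ^ 2 + e 1 ^ 2 = 1 := by rw [← norm_sq_eq_of_fin_two, he, one_pow]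
  have hζ2 := norm_sq_eq_of_fin_two ζ
  have h : ‖axisTubeVec e ζ‖ ^ 2 = 1 := by
    rw [norm_sq_fin_four]
    simp only [axisTubeVec_apply_zero, axisTubeVec_apply_one, axisTubeVec_apply_two,
      axisTubeVec_apply_three]
    rw [mul_pow, mul_pow, Real.sq_sqrt h1]
    nlinarith [he2, hζ2]
  have h0 : 0 ≤ ‖axisTubeVec e ζ‖ := norm_nonneg _
  nlinarith [h, h0]

/-- The tube coordinates are smooth in `(e, ζ)` on `{|ζ| < 1}`. [folklore] -/
theorem contDiffAt_axisTubeVec {q : 𝔼 2 × 𝔼 2} (hq : ‖q.2‖ < 1) {n : WithTop ℕ∞} :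
    ContDiffAt ℝ n (fun p : 𝔼 2 × 𝔼 2 ↦ axisTubeVec p.1 p.2) q := by
  have he : ∀ i : Fin 2, ContDiff ℝ n fun p : 𝔼 2 × 𝔼 2 ↦ p.1 i := fun i ↦
    (contDiff_euclidean.1 contDiff_fst i)
  have hz : ∀ i : Fin 2, ContDiff ℝ n fun p : 𝔼 2 × 𝔼 2 ↦ p.2 i := fun i ↦
    (contDiff_euclidean.1 contDiff_snd i)
  have hsq : ContDiff ℝ n fun p : 𝔼 2 × 𝔼 2 ↦ 1 - ‖p.2‖ ^ 2 :=
    contDiff_const.sub ((contDiff_norm_sq ℝ).comp contDiff_snd)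
  have hpos : 1 - ‖q.2‖ ^ 2 ≠ 0 := by nlinarith [norm_nonneg q.2]
  have hsqrt : ContDiffAt ℝ n (fun p : 𝔼 2 × 𝔼 2 ↦ Real.sqrt (1 - ‖p.2‖ ^ 2)) q :=
    hsq.contDiffAt.sqrt hpos
  rw [contDiffAt_euclidean]
  intro i
  fin_cases i
  · exact (hz 0).contDiffAt
  · exact (hz 1).contDiffAt
  · exact hsqrt.mul (he 0).contDiffAt
  · exact hsqrt.mul (he 1).contDiffAt

/-- `x₃ ≤ ‖x‖`-type bound: the last tube coordinate is at most `1` in absolute value. [folklore] -/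
theorem dilDen_axisTubeVec_pos {a : ℝ} (ha : a ≠ 0) {e ζ : 𝔼 2} (he : ‖e‖ = 1) (hζ : ‖ζ‖ ≤ 1) :
    0 < dilDen a (axisTubeVec e ζ) :=
  dilDen_pos_of_norm_eq_one ha (norm_axisTubeVec he hζ)

/-- **The outer chart** `outerPt k e ζ = 𝔇_a (axisTubeVec e ζ)`, `a = focal k`: tube coordinates
about the axis `A = 𝔇_a {x₀ = x₁ = 0}` (the vertical axis of the standard picture together with
the point at infinity) in which the revolved circle `|z| = R'_k` of the planar half-plane is the
coordinate torus `|ζ| = a / C_k`. [folklore] -/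
def outerPt (k : ℕ) (e ζ : 𝔼 2) : 𝔼 4 :=
  dilCoe (focal k) (axisTubeVec e ζ)

/-- The outer chart lands on the unit sphere. [folklore] -/
theorem norm_outerPt {e ζ : 𝔼 2} (he : ‖e‖ = 1) (hζ : ‖ζ‖ ≤ 1) : ‖outerPt k e ζ‖ = 1 :=
  norm_dilCoe (dilDen_axisTubeVec_pos focal_ne_zero he hζ).ne' (norm_axisTubeVec he hζ)

/-- The outer chart is smooth in `(e, ζ)` at points with `|e| = 1`, `|ζ| < 1`. [folklore] -/
theorem contDiffAt_outerPt {q : 𝔼 2 × 𝔼 2} (he : ‖q.1‖ = 1) (hq : ‖q.2‖ < 1) {n : WithTop ℕ∞} :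
    ContDiffAt ℝ n (fun p : 𝔼 2 × 𝔼 2 ↦ outerPt k p.1 p.2) q :=
  (contDiffAt_dilCoe (dilDen_axisTubeVec_pos focal_ne_zero he hq.le).ne').comp q
    (contDiffAt_axisTubeVec hq)

/-- **Inverting the outer chart**: `𝔇_{1/a} (outerPt k e ζ) = axisTubeVec e ζ`, from which `ζ`
(first two coordinates) and `√(1 − |ζ|²) e` (last two) are read off. [folklore] -/
theorem dilCoe_inv_outerPt {e ζ : 𝔼 2} (he : ‖e‖ = 1) (hζ : ‖ζ‖ ≤ 1) :
    dilCoe (focal k)⁻¹ (outerPt k e ζ) = axisTubeVec e ζ :=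
  dilCoe_inv_dilCoe focal_ne_zero (dilDen_axisTubeVec_pos focal_ne_zero he hζ).ne'

/-- The outer chart is injective on `{|e| = 1} × {|ζ| < 1}`. [folklore] -/
theorem outerPt_injective {e e' ζ ζ' : 𝔼 2} (he : ‖e‖ = 1) (he' : ‖e'‖ = 1) (hζ : ‖ζ‖ < 1)
    (hζ' : ‖ζ'‖ < 1) (h : outerPt k e ζ = outerPt k e' ζ') : e = e' ∧ ζ = ζ' := by
  have h1 := dilCoe_inv_outerPt (k := k) he hζ.le
  rw [h, dilCoe_inv_outerPt he' hζ'.le] at h1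
  -- `h1 : axisTubeVec e' ζ' = axisTubeVec e ζ`
  have h0 : ζ' 0 = ζ 0 := by simpa using congrArg (· 0) h1
  have h1' : ζ' 1 = ζ 1 := by simpa using congrArg (· 1) h1
  have hζe : ζ' = ζ := by
    ext i; fin_cases i
    · exact h0
    · exact h1'
  have hs : 0 < Real.sqrt (1 - ‖ζ‖ ^ 2) := Real.sqrt_pos.2 (by nlinarith [norm_nonneg ζ])
  have h2 : Real.sqrt (1 - ‖ζ‖ ^ 2) * e' 0 = Real.sqrt (1 - ‖ζ‖ ^ 2) * e 0 := by
    simpa [hζe] using congrArg (· 2) h1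
  have h3 : Real.sqrt (1 - ‖ζ‖ ^ 2) * e' 1 = Real.sqrt (1 - ‖ζ‖ ^ 2) * e 1 := by
    simpa [hζe] using congrArg (· 3) h1
  refine ⟨?_, hζe.symm⟩
  ext i; fin_cases i
  · exact (mul_left_cancel₀ hs.ne' h2).symm
  · exact (mul_left_cancel₀ hs.ne' h3).symm

/-! ## Latitude and co-latitude of a planar point -/

/-- `Σ_k(z) = ρ² + h² + a²`, `ρ = Re z + C_k`, `h = Im z`. [folklore] -/
def outerDen (k : ℕ) (z : ℂ) : ℝ := (z.re + drawRadius k) ^ 2 + z.im ^ 2 + focal k ^ 2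

/-- `Σ_k(z) > 0`. [folklore] -/
theorem outerDen_pos (z : ℂ) : 0 < outerDen k z := by
  unfold outerDen
  have := focal_pos (k := k)
  positivity

/-- **The latitude** `s_k(z) = 2aρ/(ρ² + h² + a²)` of the planar point `z`: the distance from the
axis circle, in the tube coordinates `axisTubeVec`, of the dilated picture point
`𝔇_{1/a} (toSphereThree ((ρ u), h))` (any `u ∈ 𝕊¹`). [folklore] -/
def latS (k : ℕ) (z : ℂ) : ℝ := 2 * focal k * (z.re + drawRadius k) / outerDen k z

/-- **The co-latitude vector** `y_k(z) = (2ah, ρ² + h² − a²)/(ρ² + h² + a²)`: the last two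
coordinates of the dilated picture point; its direction is the position along the axis circle.
[folklore] -/
def coLat (k : ℕ) (z : ℂ) : 𝔼 2 :=
  WithLp.toLp 2 ![2 * focal k * z.im / outerDen k z,
    ((z.re + drawRadius k) ^ 2 + z.im ^ 2 - focal k ^ 2) / outerDen k z]

/-- Coordinate `0` of the co-latitude vector. [folklore] -/
@[simp] theorem coLat_apply_zero (z : ℂ) : coLat k z 0 = 2 * focal k * z.im / outerDen k z := rfl
/-- Coordinate `1` of the co-latitude vector. [folklore] -/
@[simp] theorem coLat_apply_one (z : ℂ) :
    coLat k z 1 = ((z.re + drawRadius k) ^ 2 + z.im ^ 2 - focal k ^ 2) / outerDen k z := rfl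

/-- The direction of the co-latitude vector (junk `0` at the focus `z = a − C_k`). [folklore] -/
def coLatDir (k : ℕ) (z : ℂ) : 𝔼 2 := ‖coLat k z‖⁻¹ • coLat k z

/-- **`s² + |y|² = 1`.** [folklore] -/
theorem latS_sq_add_norm_coLat_sq (z : ℂ) : latS k z ^ 2 + ‖coLat k z‖ ^ 2 = 1 := by
  have hS := outerDen_pos (k := k) z
  rw [norm_sq_eq_of_fin_two, coLat_apply_zero, coLat_apply_one, latS, div_pow, div_pow, div_pow,
    ← add_div, ← add_div, div_eq_one_iff_eq (by positivity)]
  unfold outerDen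
  ring

/-- `0 ≤ s` on the half-plane `ρ ≥ 0`. [folklore] -/
theorem latS_nonneg {z : ℂ} (hz : 0 ≤ z.re + drawRadius k) : 0 ≤ latS k z :=
  div_nonneg (mul_nonneg (mul_nonneg zero_le_two focal_pos.le) hz) (outerDen_pos z).le

/-- `s ≤ 1`. [folklore] -/
theorem latS_le_one (z : ℂ) : latS k z ≤ 1 := by
  have h := latS_sq_add_norm_coLat_sq (k := k) z
  nlinarith [sq_nonneg ‖coLat k z‖, sq_nonneg (latS k z - 1)]

/-- `|y| = √(1 − s²)`. [folklore] -/
theorem norm_coLat_eq_sqrt (z : ℂ) : ‖coLat k z‖ = Real.sqrt (1 - latS k z ^ 2) := by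
  rw [← latS_sq_add_norm_coLat_sq (k := k) z, add_sub_cancel_left, Real.sqrt_sq (norm_nonneg _)]

/-- `|y| • (y/|y|) = y` (also at `y = 0`). [folklore] -/
theorem norm_smul_coLatDir (z : ℂ) : ‖coLat k z‖ • coLatDir k z = coLat k z := by
  unfold coLatDir
  by_cases h : coLat k z = 0
  · simp [h]
  · rw [smul_smul, mul_inv_cancel₀ (norm_ne_zero_iff.2 h), one_smul]

/-- `|y/|y|| = 1` off the focus. [folklore] -/
theorem norm_coLatDir {z : ℂ} (h : coLat k z ≠ 0) : ‖coLatDir k z‖ = 1 := by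
  rw [coLatDir, norm_smul, norm_inv, norm_norm, inv_mul_cancel₀ (norm_ne_zero_iff.2 h)]

/-- `|y| (y/|y|)_i = y_i`. [folklore] -/
theorem norm_mul_coLatDir_apply (z : ℂ) (i : Fin 2) :
    ‖coLat k z‖ * coLatDir k z i = coLat k z i := by
  rw [show ‖coLat k z‖ * coLatDir k z i = (‖coLat k z‖ • coLatDir k z) i by simp,
    norm_smul_coLatDir]

/-- **The dilated picture point in tube coordinates**: for a unit vector `u`,
`axisTubeVec (y/|y|) (s • u) = σ⁻¹ ((ρ/a) u, h/a)`. [folklore] -/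
theorem axisTubeVec_coLatDir_latS (z : ℂ) {u : 𝔼 2} (hu : ‖u‖ = 1) :
    axisTubeVec (coLatDir k z) (latS k z • u) =
      stereoNorthInvCoe ((focal k)⁻¹ • (((z.re + drawRadius k) * u 0,
        (z.re + drawRadius k) * u 1), z.im)) := by
  have ha := focal_ne_zero (k := k)
  have hS := outerDen_pos (k := k) z
  have hu2 : u 0 ^ 2 + u 1 ^ 2 = 1 := by rw [← norm_sq_eq_of_fin_two, hu, one_pow]
  set y : (ℝ × ℝ) × ℝ := (focal k)⁻¹ • (((z.re + drawRadius k) * u 0,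
    (z.re + drawRadius k) * u 1), z.im) with hy
  have hy1 : y.1.1 = (focal k)⁻¹ * ((z.re + drawRadius k) * u 0) := rfl
  have hy2 : y.1.2 = (focal k)⁻¹ * ((z.re + drawRadius k) * u 1) := rfl
  have hy3 : y.2 = (focal k)⁻¹ * z.im := rfl
  -- the radius of the chart point
  have hr : stereoNorthRadSq y + 1 = outerDen k z / focal k ^ 2 := by
    rw [stereoNorthRadSq, hy1, hy2, hy3]
    unfold outerDen
    field_simp
    nlinarith [hu2]
  have hr' : stereoNorthRadSq y = outerDen k z / focal k ^ 2 - 1 := by linarith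
  -- `√(1 - |s u|²) = |y|`
  have hsq : Real.sqrt (1 - ‖latS k z • u‖ ^ 2) = ‖coLat k z‖ := by
    rw [norm_smul, mul_pow, hu, one_pow, mul_one, Real.norm_eq_abs, sq_abs, norm_coLat_eq_sqrt]
  ext i
  fin_cases i
  · show axisTubeVec (coLatDir k z) (latS k z • u) 0 = stereoNorthInvCoe y 0
    rw [axisTubeVec_apply_zero, stereoNorthInvCoe_apply_zero, hr, hy1, PiLp.smul_apply,
      smul_eq_mul, latS]
    field_simp
  · show axisTubeVec (coLatDir k z) (latS k z • u) 1 = stereoNorthInvCoe y 1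
    rw [axisTubeVec_apply_one, stereoNorthInvCoe_apply_one, hr, hy2, PiLp.smul_apply,
      smul_eq_mul, latS]
    field_simp
  · show axisTubeVec (coLatDir k z) (latS k z • u) 2 = stereoNorthInvCoe y 2
    rw [axisTubeVec_apply_two, stereoNorthInvCoe_apply_two, hr, hy3, hsq,
      norm_mul_coLatDir_apply, coLat_apply_zero]
    field_simp
  · show axisTubeVec (coLatDir k z) (latS k z • u) 3 = stereoNorthInvCoe y 3
    rw [axisTubeVec_apply_three, stereoNorthInvCoe_apply_three, hr, hr', hsq,
      norm_mul_coLatDir_apply, coLat_apply_one]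
    field_simp
    unfold outerDen
    ring

/-- **The picture point through the outer chart**: for a unit vector `u`,
`outerPt k (y/|y|) (s • u) = σ⁻¹ ((ρ u), h)` — the inverse stereographic image of the chart point
with planar position `ρ u` and height `h`. [folklore] -/
theorem outerPt_coLatDir_latS (z : ℂ) {u : 𝔼 2} (hu : ‖u‖ = 1) :
    outerPt k (coLatDir k z) (latS k z • u) =
      stereoNorthInvCoe ((((z.re + drawRadius k) * u 0, (z.re + drawRadius k) * u 1), z.im)) := by
  rw [outerPt, axisTubeVec_coLatDir_latS z hu, dilCoe_stereoNorthInvCoe, smul_smul,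
    mul_inv_cancel₀ focal_ne_zero, one_smul]

/-! ## The inverse parametrisation `outerZ` of the planar half-plane -/

/-- **The planar point with co-latitude direction `e` and latitude `s`**:
`Z_k(e, s) = (a s/(1 − q) − C_k, a√(1 − s²) e₀/(1 − q))`, `q = √(1 − s²) e₁`. [folklore] -/
def outerZ (k : ℕ) (e : 𝔼 2) (s : ℝ) : ℂ :=
  ⟨focal k * s / (1 - Real.sqrt (1 - s ^ 2) * e 1) - drawRadius k,
    focal k * Real.sqrt (1 - s ^ 2) * e 0 / (1 - Real.sqrt (1 - s ^ 2) * e 1)⟩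

/-- Real part of `Z_k(e, s)`. [folklore] -/
@[simp] theorem outerZ_re (e : 𝔼 2) (s : ℝ) : (outerZ k e s).re =
    focal k * s / (1 - Real.sqrt (1 - s ^ 2) * e 1) - drawRadius k := rfl
/-- Imaginary part of `Z_k(e, s)`. [folklore] -/
@[simp] theorem outerZ_im (e : 𝔼 2) (s : ℝ) : (outerZ k e s).im =
    focal k * Real.sqrt (1 - s ^ 2) * e 0 / (1 - Real.sqrt (1 - s ^ 2) * e 1) := rfl

/-- `1 − √(1 − s²) e₁ > 0` for `0 < s`, `|e| ≤ 1`. [folklore] -/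
theorem one_sub_sqrt_mul_pos {s : ℝ} (hs : 0 < s) {e : 𝔼 2} (he : ‖e‖ ≤ 1) :
    0 < 1 - Real.sqrt (1 - s ^ 2) * e 1 := by
  have h1 : Real.sqrt (1 - s ^ 2) < 1 := (Real.sqrt_lt' one_pos).2 (by nlinarith)
  have h0 : 0 ≤ Real.sqrt (1 - s ^ 2) := Real.sqrt_nonneg _
  have he1 : e 1 ≤ 1 := by
    have h2 : e 1 ^ 2 ≤ ‖e‖ ^ 2 := by rw [norm_sq_eq_of_fin_two]; nlinarith [sq_nonneg (e 0)]
    nlinarith [norm_nonneg e, sq_nonneg (e 1 - 1)]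
  nlinarith

/-- `Σ ∘ Z = 2a²/(1 − q)`. [folklore] -/
theorem outerDen_outerZ {e : 𝔼 2} (he : ‖e‖ = 1) {s : ℝ} (hs : 0 < s) (hs1 : s ≤ 1) :
    outerDen k (outerZ k e s) = 2 * focal k ^ 2 / (1 - Real.sqrt (1 - s ^ 2) * e 1) := by
  have hq := one_sub_sqrt_mul_pos hs he.le
  have he2 : e 0 ^ 2 + e 1 ^ 2 = 1 := by rw [← norm_sq_eq_of_fin_two, he, one_pow]
  have hroot : Real.sqrt (1 - s ^ 2) ^ 2 = 1 - s ^ 2 := Real.sq_sqrt (by nlinarith)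
  have h2 : (1 - Real.sqrt (1 - s ^ 2) * e 1) ^ 2 ≠ 0 := pow_ne_zero 2 hq.ne'
  have key : (focal k * s) ^ 2 + (focal k * Real.sqrt (1 - s ^ 2) * e 0) ^ 2 +
      focal k ^ 2 * (1 - Real.sqrt (1 - s ^ 2) * e 1) ^ 2 =
      2 * focal k ^ 2 * (1 - Real.sqrt (1 - s ^ 2) * e 1) := by
    linear_combination (focal k ^ 2 * Real.sqrt (1 - s ^ 2) ^ 2) * he2 + focal k ^ 2 * hroot
  unfold outerDen
  rw [outerZ_re, outerZ_im, sub_add_cancel, div_pow, div_pow, ← add_div, div_add' _ _ _ h2,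
    div_eq_div_iff h2 hq.ne']
  linear_combination (1 - Real.sqrt (1 - s ^ 2) * e 1) * key

/-- **`s ∘ Z = s`**: the latitude of `Z_k(e, s)` is `s` (`|e| = 1`, `0 < s ≤ 1`). [folklore] -/
theorem latS_outerZ {e : 𝔼 2} (he : ‖e‖ = 1) {s : ℝ} (hs : 0 < s) (hs1 : s ≤ 1) :
    latS k (outerZ k e s) = s := by
  have hq := one_sub_sqrt_mul_pos hs he.le
  have ha := focal_pos (k := k)
  rw [latS, outerDen_outerZ he hs hs1, outerZ_re, sub_add_cancel]
  field_simp

/-- **`y ∘ Z = √(1 − s²) e`**: the co-latitude vector of `Z_k(e, s)`. [folklore] -/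
theorem coLat_outerZ {e : 𝔼 2} (he : ‖e‖ = 1) {s : ℝ} (hs : 0 < s) (hs1 : s ≤ 1) :
    coLat k (outerZ k e s) = Real.sqrt (1 - s ^ 2) • e := by
  have hq := one_sub_sqrt_mul_pos hs he.le
  have ha := focal_pos (k := k)
  have he2 : e 0 ^ 2 + e 1 ^ 2 = 1 := by rw [← norm_sq_eq_of_fin_two, he, one_pow]
  have hroot : Real.sqrt (1 - s ^ 2) ^ 2 = 1 - s ^ 2 := Real.sq_sqrt (by nlinarith)
  have hden := outerDen_outerZ (k := k) he hs hs1
  have hnum : (focal k * s / (1 - Real.sqrt (1 - s ^ 2) * e 1)) ^ 2 +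
      (focal k * Real.sqrt (1 - s ^ 2) * e 0 / (1 - Real.sqrt (1 - s ^ 2) * e 1)) ^ 2 -
      focal k ^ 2 = 2 * focal k ^ 2 * (Real.sqrt (1 - s ^ 2) * e 1) /
        (1 - Real.sqrt (1 - s ^ 2) * e 1) := by
    have h2 : (1 - Real.sqrt (1 - s ^ 2) * e 1) ^ 2 ≠ 0 := pow_ne_zero 2 hq.ne'
    rw [div_pow, div_pow, ← add_div, sub_eq_iff_eq_add, div_add' _ _ _ hq.ne',
      div_eq_div_iff h2 hq.ne']
    linear_combination ((1 - Real.sqrt (1 - s ^ 2) * e 1) * focal k ^ 2 *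
      Real.sqrt (1 - s ^ 2) ^ 2) * he2 + ((1 - Real.sqrt (1 - s ^ 2) * e 1) * focal k ^ 2) * hroot
  ext i
  fin_cases i
  · rw [Fin.zero_eta, coLat_apply_zero, outerZ_im, hden, PiLp.smul_apply, smul_eq_mul]
    field_simp
  · rw [Fin.mk_one, coLat_apply_one, outerZ_re, outerZ_im, sub_add_cancel, hnum, hden,
      PiLp.smul_apply, smul_eq_mul]
    field_simp

/-- `y ∘ Z` has direction `e` (`0 < s < 1`). [folklore] -/
theorem coLatDir_outerZ {e : 𝔼 2} (he : ‖e‖ = 1) {s : ℝ} (hs : 0 < s) (hs1 : s < 1) :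
    coLatDir k (outerZ k e s) = e := by
  have ht : 0 < Real.sqrt (1 - s ^ 2) := Real.sqrt_pos.2 (by nlinarith)
  rw [coLatDir, coLat_outerZ he hs hs1.le, norm_smul, Real.norm_of_nonneg ht.le, he, mul_one,
    smul_smul, inv_mul_cancel₀ ht.ne', one_smul]

/-- **`Z ∘ (y/|y|, s) = id`** (on all of `ℂ`, thanks to the junk conventions). [folklore] -/
theorem outerZ_coLatDir_latS (z : ℂ) : outerZ k (coLatDir k z) (latS k z) = z := by
  have ha := focal_pos (k := k)
  have hS := outerDen_pos (k := k) z
  have hsq : Real.sqrt (1 - latS k z ^ 2) = ‖coLat k z‖ := (norm_coLat_eq_sqrt z).symm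
  have h0 : Real.sqrt (1 - latS k z ^ 2) * coLatDir k z 0 = coLat k z 0 := by
    rw [hsq, show ‖coLat k z‖ * coLatDir k z 0 = (‖coLat k z‖ • coLatDir k z) 0 by simp,
      norm_smul_coLatDir]
  have h1 : Real.sqrt (1 - latS k z ^ 2) * coLatDir k z 1 = coLat k z 1 := by
    rw [hsq, show ‖coLat k z‖ * coLatDir k z 1 = (‖coLat k z‖ • coLatDir k z) 1 by simp,
      norm_smul_coLatDir]
  have hq : 1 - coLat k z 1 = 2 * focal k ^ 2 / outerDen k z := by
    rw [coLat_apply_one]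
    field_simp
    unfold outerDen
    ring
  apply Complex.ext
  · rw [outerZ_re, h1, hq, latS]
    field_simp
    ring
  · rw [outerZ_im, mul_assoc, h0, h1, hq, coLat_apply_zero]
    field_simp

/-- **The exact distance formula** `|Z_k(e, s)|² = R'_k² + 2a(a − C_k s)/(1 − √(1 − s²) e₁)`.
[folklore] -/
theorem normSq_outerZ {e : 𝔼 2} (he : ‖e‖ = 1) {s : ℝ} (hs : 0 < s) (hs1 : s ≤ 1) :
    Complex.normSq (outerZ k e s) = bigRadius k ^ 2 +
      2 * focal k * (focal k - drawRadius k * s) / (1 - Real.sqrt (1 - s ^ 2) * e 1) := by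
  have hq := one_sub_sqrt_mul_pos hs he.le
  have he2 : e 0 ^ 2 + e 1 ^ 2 = 1 := by rw [← norm_sq_eq_of_fin_two, he, one_pow]
  have hroot : Real.sqrt (1 - s ^ 2) ^ 2 = 1 - s ^ 2 := Real.sq_sqrt (by nlinarith)
  have hf := focal_sq (k := k)
  -- clear the denominator `1 - q`
  rw [Complex.normSq_apply, outerZ_re, outerZ_im, ← sub_eq_zero]
  have key : (focal k * s / (1 - Real.sqrt (1 - s ^ 2) * e 1) - drawRadius k) *
      (focal k * s / (1 - Real.sqrt (1 - s ^ 2) * e 1) - drawRadius k) +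
      focal k * Real.sqrt (1 - s ^ 2) * e 0 / (1 - Real.sqrt (1 - s ^ 2) * e 1) *
      (focal k * Real.sqrt (1 - s ^ 2) * e 0 / (1 - Real.sqrt (1 - s ^ 2) * e 1)) -
      (bigRadius k ^ 2 + 2 * focal k * (focal k - drawRadius k * s) /
        (1 - Real.sqrt (1 - s ^ 2) * e 1)) =
      ((focal k * s - drawRadius k * (1 - Real.sqrt (1 - s ^ 2) * e 1)) ^ 2 +
        focal k ^ 2 * Real.sqrt (1 - s ^ 2) ^ 2 * e 0 ^ 2 -
        bigRadius k ^ 2 * (1 - Real.sqrt (1 - s ^ 2) * e 1) ^ 2 -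
        2 * focal k * (focal k - drawRadius k * s) * (1 - Real.sqrt (1 - s ^ 2) * e 1)) /
        (1 - Real.sqrt (1 - s ^ 2) * e 1) ^ 2 := by
    field_simp
    ring
  rw [key, div_eq_zero_iff]
  left
  linear_combination (focal k ^ 2 * Real.sqrt (1 - s ^ 2) ^ 2) * he2 + focal k ^ 2 * hroot -
    (1 - Real.sqrt (1 - s ^ 2) * e 1) ^ 2 * hf

/-- **The distance from the origin in terms of the latitude**, for any planar point:
`|z|² − R'_k² = (a − C_k s)Σ/a`. [folklore] -/
theorem normSq_sub_bigRadius_sq (z : ℂ) : Complex.normSq z - bigRadius k ^ 2 =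
    (focal k - drawRadius k * latS k z) * outerDen k z / focal k := by
  have ha := focal_ne_zero (k := k)
  have hS := (outerDen_pos (k := k) z).ne'
  have hf := focal_sq (k := k)
  rw [latS, Complex.normSq_apply]
  field_simp
  unfold outerDen
  nlinarith [hf]

/-- `|z| ≤ R'_k` iff `s ≥ a/C_k`, quantitatively: `|z|² ≤ R'²` iff `C_k s ≥ a`. [folklore] -/
theorem normSq_le_bigRadius_sq_iff (z : ℂ) :
    Complex.normSq z ≤ bigRadius k ^ 2 ↔ focal k ≤ drawRadius k * latS k z := by
  have h := normSq_sub_bigRadius_sq (k := k) z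
  have ha := focal_pos (k := k)
  have hS := outerDen_pos (k := k) z
  constructor
  · intro hle
    by_contra hlt
    push Not at hlt
    have : 0 < (focal k - drawRadius k * latS k z) * outerDen k z / focal k := by
      apply div_pos _ ha
      exact mul_pos (by linarith) hS
    linarith
  · intro hle
    have : (focal k - drawRadius k * latS k z) * outerDen k z / focal k ≤ 0 :=
      div_nonpos_of_nonpos_of_nonneg (mul_nonpos_of_nonpos_of_nonneg (by linarith) hS.le) ha.le
    linarith

end MMSW

end Literature.Topology.FourManifolds
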